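import Summits.AtomisticToContinuum.FouriersLaw.Theses.ParityLiouvilleSeed
import Summits.AtomisticToContinuum.FouriersLaw.Theorems.ParityLiouvilleSeedWindowLimitTimeInvariance
import Summits.AtomisticToContinuum.FouriersLaw.Theorems.ParityLiouvilleSeedWindowLimitEntropy

/-!
# `WindowLimit` — bulk-window compactness and stationarity transfer (route `ParityLiouvilleSeed`)

Closes the route item `stmt-AtomisticToContinuum-13982`
(`Summit.AtomisticToContinuum.FouriersLaw.Theses.ParityLiouvilleSeed.WindowLimit`): for ANY real parameters
`ω₂ lam β γ T_L T_R` and any family `μ_N` of weak steady states of the `N`-site pinned chain with site-uniform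
moments of all orders and uniform regularity w.r.t. a shift-invariant Gibbs reference, if
`ε ≤ |totalCurrent(μ_N)/(N-1)|` frequently, then some probability measure `ν` on `(ℝ × ℝ)^ℤ` is time invariant
(Bernardin's generator form), translation bounded, uniformly regular w.r.t. the same reference, with
`j₀ ∈ L¹(ν)` and `ε ≤ |∫ j₀ dν|`.

Proof (`windowLimit_proof`), assembling the helper files `ParityLiouvilleSeedWindowLimit*.lean`:
1. all bulk bond currents of a steady state agree (continuity equation + weak stationarity extended,
   sign-free, to polynomially bounded bulk observables), so `(N-1)|J̃_N| ≤ (N-3)|J_centre| + B`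
   (`centre_current_lower_bound`);
2. along the lengths where `ε ≤ |J̃_N|` the centred window measures `(μ_N).map (embed N ⌊N/2⌋)` are tight
   (site-uniform second moments) and a subsequence converges weakly (Prokhorov, `exists_weak_limit`);
3. the limit is time invariant (`isTimeInvariant_window_limit`: `L_N` on bulk-window observables IS `𝒜`,
   mollification of `C₀¹` profiles, transfer of window averages), translation bounded
   (`moments_of_window_limit`), uniformly regular (`klDiv_boxMarginal_window_limit_le`: weak lower
   semicontinuity of the relative entropy, shift invariance of the reference), and carries the limiting centre
   current (`current_of_window_limit`), whose modulus is `≥ ε`.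
-/

noncomputable section

namespace Summit.AtomisticToContinuum.FouriersLaw.Theorems

open MeasureTheory Filter Topology Set
open Literature.MathematicalPhysics.KineticTheory.HeatConduction
open WindowLimit

/-- **`WindowLimit` (route `ParityLiouvilleSeed`, item `stmt-AtomisticToContinuum-13982`): bulk-window
compactness and stationarity transfer for weak steady states of the pinned anharmonic chain, any real
parameters.** [Eyink–Lebowitz–Spohn 1991 architecture; Kipnis–Landim 1999 (weak compactness, entropy
l.s.c.); Bonetto–Lebowitz–Rey-Bellet 2000 §5.2 (steady currents)] -/
theorem windowLimit_proof :
    Summit.AtomisticToContinuum.FouriersLaw.Theses.ParityLiouvilleSeed.WindowLimit := by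
  intro ω₂ lam β γ T_L T_R μ hss hmom hreg ε hε hfreq
  set P := pinnedChain ω₂ lam β γ with hP
  have hprob : ∀ N, IsProbabilityMeasure (μ N) := fun N => (hss N).1
  obtain ⟨B, hB⟩ := centre_current_lower_bound (T_L := T_L) (T_R := T_R) μ hss hmom
  have hfreq' : ∃ᶠ N in atTop, ε ≤ |P.totalCurrent (μ N) / ((N : ℝ) - 1)| ∧ 6 ≤ N :=
    hfreq.and_eventually (eventually_ge_atTop 6)
  obtain ⟨φ, hφmono, hφ⟩ := extraction_of_frequently_atTop hfreq'
  obtain ⟨ψ, ν, hν, hψmono, hlim⟩ := exists_weak_limit (T_L := T_L) (T_R := T_R) μ hss hmom φ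
  haveI := hν
  have hNk : Tendsto (fun k => φ (ψ k)) atTop atTop := hφmono.tendsto_atTop.comp hψmono.tendsto_atTop
  refine ⟨ν, hν, isTimeInvariant_window_limit μ hss hmom hNk hlim,
    moments_of_window_limit μ hprob hmom hlim, ?_, (current_of_window_limit (ω₂ := ω₂) (lam := lam) (β := β)
      (γ := γ) μ hprob hmom hNk hlim).1, ?_⟩
  · obtain ⟨T, μT, hT, hG, hS, C, hC, hregC⟩ := hreg
    haveI := hG.isProbabilityMeasure
    exact ⟨T, μT, hT, hG, hS, C, hC, fun a n => klDiv_boxMarginal_window_limit_le μ hprob hNk hlim hS hC hregC a n⟩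
  · -- `ε ≤ |∫ j₀ dν|` from `(N-1) ε ≤ (N-3) |J_N| + B` along the subsequence
    have hcur : Tendsto (fun k => |centreCurrent P (μ (φ (ψ k)))|) atTop
        (𝓝 |∫ σ, P.bondCurrentZ σ 0 ∂ν|) := (current_of_window_limit μ hprob hmom hNk hlim).2.abs
    have hN3 : Tendsto (fun k => ((φ (ψ k) : ℕ) : ℝ) - 3) atTop atTop :=
      tendsto_atTop_add_const_right _ _ (tendsto_natCast_atTop_atTop.comp hNk)
    have hlow : Tendsto (fun k => ε + (2 * ε - B) / (((φ (ψ k) : ℕ) : ℝ) - 3)) atTop (𝓝 ε) := by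
      have h := (tendsto_const_nhds (x := 2 * ε - B)).div_atTop hN3
      simpa using (tendsto_const_nhds (x := ε)).add h
    refine le_of_tendsto_of_tendsto hlow hcur (Eventually.of_forall fun k => ?_)
    obtain ⟨hεk, h6⟩ := hφ (ψ k)
    have hBk := hB (φ (ψ k)) h6
    set Nr : ℝ := ((φ (ψ k) : ℕ) : ℝ) with hNr
    have h6r : (6 : ℝ) ≤ Nr := by rw [hNr]; exact_mod_cast h6
    have hN1 : 0 < Nr - 1 := by linarith
    have hN3' : 0 < Nr - 3 := by linarith
    have h1 : (Nr - 1) * ε ≤ (Nr - 3) * |centreCurrent P (μ (φ (ψ k)))| + B :=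
      (mul_le_mul_of_nonneg_left hεk hN1.le).trans hBk
    have h2 : ε + (2 * ε - B) / (Nr - 3) = ((Nr - 1) * ε - B) / (Nr - 3) := by
      field_simp
      ring
    show ε + (2 * ε - B) / (Nr - 3) ≤ |centreCurrent P (μ (φ (ψ k)))|
    rw [h2, div_le_iff₀ hN3']
    linarith

end Summit.AtomisticToContinuum.FouriersLaw.Theorems

end
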